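/-
Copyright (c) 2026 the pub-hodgecm-mathlib formalisation cell (harness21).  Prover seat hodgecm-mathlib-LH7-p04 (g9), (G1) «glue-PC» of the E3a (L2) glue (pen LH3-p04 (g8) carving
line 2026-09-02 17:56:25Z; dealer LH2-plan (g1)).
-/
import Literature.NumberTheory.Rogawski1990.ArchEPAssemblyBall           -- ★ (L2) p852268∕p852284 (LH7-p04 (g8)): §1 `exists_uniform_radius_pi`, §2 `contDiff_weight_of_tsupport_subset`, §3 `exists_epGenerator_choice_pi`; brings ★ (L1), ★ E3b, `EPGeneratorAt`, `esymm3`, `orbFamGExt`, `stableSumG`, `bzClassG`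
import Literature.NumberTheory.Rogawski1990.ArchEPAssemblyTestFunction   -- ★ §2(7) p852249 (LH7-p01 (g7)): `archSmooth_prod_classMul_tensor_mul_coupling_of_forall_eq_zero` (the per-ball test function is `ArchSmooth`)
import Literature.NumberTheory.Rogawski1990.ArchEPAssemblyDefiniteSwap  -- ★ (s1) p852258 (LH3-p03 (g8)): the `α`-side average tokens (`archPiEquivCM`, `MeasurableEquiv.piEquivPiSubtypeProd`, `gprimeBlockAt`); brings ★ E2a∕E2b
import Literature.NumberTheory.Automorphic.ArchInnerFormChartOrbLocalCongr -- ★ `gprimeBlockAt_eq_of_mem_iff` (the chart block reads the label only through `w ∈ S′`)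
import Literature.NumberTheory.Rogawski1990.ArchEPAssemblyMeasures     -- ★ (L2)-measures p852313 (LH3-p04 (g8)): the CONSUMER `exists_radius_ballTransferFixedBody_of_prodConvention` (output seam); brings ★ `isHaarMeasure_prodConventionG`, `isMulRightInvariant_prodConventionG`
import HarnessLib

/-!
**TSUPPORT TWIN** (pen LH3-p04 (g8) ruling 2026-09-02 18:14Z on LH3-p03 (g8)'s re-letter): this file is ★ p852328 `ArchEPAssemblyBallTransfer.lean` VERBATIM with ONE clause
added to the readings-dock letter `hBI` — the CLOSED support `∀ v, tsupport (F v) ⊆ ball (y v) (εg v)` of the partition factor (the combinator has it from the ball selection) —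
so that the dock (★ (BI) `ballIdentity_of_slices`) can make the inline weight `2F∕h` continuous at the sphere; the open-support clause alone does not.

# EP ASSEMBLY, (G1) «glue-PC»: the ball-by-ball transfer body in the PRODUCT CONVENTION, from the coupling, the readings dock and the ball selection
# (Rogawski 1990 §14.2 (14.2.1); Shelstad 1979 §4; Bouaziz 1994 §6.2)

Topic `NumberTheory/Rogawski1990`; namespace `Literature.NumberTheory.Rogawski1990`.  THEOREMS ONLY (no `def`, no instance, no notation, no axiom, no named fact, no `sorry` when filed).
Cell `pub/hodgecm-mathlib` (D-0151), crux H413 (`stmt-HodgeConjecture-24833`), line LH2 (closer stub `stub_N8`, organ (Sh)′), N8-INNER ROAD B «EP road» (dealer LH2-plan (g1)), brick E3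
«EP ASSEMBLY = H-S4′», layer (L2) «the glue» — pen LH3-p04 (g8)'s carving line 2026-09-02 17:56:25Z: **(G1) «glue-PC» (this file, LH7-p04 (g9))**, (BI) «readings dock» (LH3-p03 (g8),
`ArchEPAssemblyBallIdentity`), (CP) «coupling» (LH7-p01 (g8), `ArchEPAssemblyCoupling` :: `exists_coupling`), ball selection (LH1-p01 (g12), `ArchEPAssemblyBallSelection` ::
`exists_ballSelection`), (G2) the head `ballTransfer_fixed` at arbitrary Haar (pen, `ArchEPAssemblyGlue`, via ★ (L2)-measures p852313), (G3) the binder-free E3 head (LH7-p04 (g9)).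
Count-neutral.

THE MATHEMATICS (HANDOFF-E3a §3 (1)–(2), CENSUS-E3a v1.1).  Frames `α` (the `α`-definite places `D`, `hD`) and `β` (split-chart at every place), place isomorphisms `ι_{w′} : U(α)_{w′} ≃ U(β)_{w′}`
off `D` carrying `γ′`-blocks to `γ′`-blocks, Haar families `ν′_w` (frame `α`) and `νβ_w` (frame `β`) with `νβ_{w′} = (ι_{w′})_* ν′_{w′}` off `D`, and the product-convention global
measures `e_α⁻¹_* ⊗ ν′_w`, `e_β⁻¹_* ⊗ νβ_w`.  GIVEN (`hEP`) a one-place EP generator at every elliptic class of `U(β)_v`, `v ∈ D` — choice functions `(ε_v, f_v, h_v)` on the compact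
class image `K = esymm3(𝕋³)` (★ (L2)§3 `exists_epGenerator_choice_pi`) —, GIVEN (`hCoup`, LH7-p01's `exists_coupling`) for the test function `a′ ∈ C_c^∞(U(α)_∞)` and every centre
`y ∈ K^D` a radius `ε_c(y) > 0` and a coupling factor `G_y` (smooth ambient certificate; on the `ε_c`-ball of `y` its reading through `ι` is the `U(3)^D`-average of `a′`), GIVEN
(`hSel`, LH1-p01's `exists_ballSelection`) the Lebesgue-number selection `δ > 0` for the radius `y ↦ min_v ε_v(y_v) ⊓ ε_c(y)` on `K^D`, and GIVEN (`hBI`, LH3-p03's readings dock)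
the per-ball identity `SS_β(f_J) = 3^{-#D} · SS_α((Π_v F_v ∘ cl_v) · a′)` on every `RegG S` for the per-ball test function
`f_J(k) = (Π_{v ∈ D} m_v(cl_v k) f_v(k_v)) · G_y(cl_D k, k_{Dᶜ})`, `m_v = 2 F_v ∕ h_v` — THEN the `hBall` body of ★ E3-SUM ED. 2 `stableSurjG_of_ballTransfer_fixed` holds at
the product-convention pair with the CONSTANT radius `δ`: for every ball datum `(ctr ∈ K^D, F)` with `tsupport F_v ⊆ ball (ctr_v) δ`, select `y` (`hSel`), build `f_J` (★ §2 weights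
smooth since `tsupport F_v ⊆ {h_v ≠ 0}`; ★ §2(7) with the coupling's ambient certificate ⇒ `f_J ∈ C_c^∞(U(β)_∞)`), and read the identity off `hBI` (its guarded transport
hypothesis is the coupling's ball identity, moved from the label `∅` to the compact label `S` by ★ `gprimeBlockAt_eq_of_mem_iff` and ★ `bzClassMapG = esymm3 ∘ cexp` off `S`);
`3^{-#D} = ∏_{w ∈ D} 3⁻¹`.  The output is EXACTLY the `hBall` argument of ★ (L2)-measures `exists_radius_ballTransferFixedBody_of_prodConvention` (p852313 §3), which the pen's
head (G2) `ballTransfer_fixed` composes with the `ι ∕ νβ` choices.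
HONEST LABEL: HC_CM is proved only modulo the 7 printed citations (2 remaining: hLiu418 = `stmt-HodgeConjecture-24832`, h413 = `stmt-HodgeConjecture-24833`) until rung 0 closes;
count-neutral; the three displayed binders `hCoup`, `hBI`, `hSel` are not-yet-★ heads carried BY NAME (LHref-N rule) and drop one by one.

## References
* [Rogawski1990] J. D. Rogawski, *Automorphic Representations of Unitary Groups in Three Variables*, Ann. of Math. Stud. 123 (1990), §4.1 (4.1.1) p. 39; §8.2 p. 122; §14.2 (14.2.1) pp. 232–233.
* [Shelstad1979] D. Shelstad, *Characters and inner forms of a quasi-split group over ℝ*, Compositio Math. 39 (1979), §4 pp. 22–26, Lemma 4.2 p. 23.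
* [Bouaziz1994IntegralesOrbitales] A. Bouaziz, *Intégrales orbitales sur les groupes de Lie réductifs*, Ann. Sci. ÉNS (4) 27 (1994), §6.2 pp. 591–594.
* [BorelJacquet1979] A. Borel, H. Jacquet, *Automorphic forms and automorphic representations*, PSPM 33.1 (1979), §4.1.
-/

set_option autoImplicit false

noncomputable section

open MeasureTheory MeasureTheory.Measure NumberField NumberField.InfinitePlace Matrix Complex Set Function Metric Topology
open Literature.NumberTheory.Automorphic Literature.NumberTheory.Automorphic.UnitaryGroup Literature.NumberTheory.Automorphic.ArchCartan
open scoped MatrixGroups Matrix Classical ContDiff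
open scoped Matrix.Norms.Operator

namespace Literature.NumberTheory.Rogawski1990

section GluePC

variable (L : Type) [Field L] [NumberField L] [IsCMField L] (α β : Fin 3 → L) (D : Finset {w : InfinitePlace L // IsComplex w})
  [∀ w : {w : InfinitePlace L // IsComplex w}, MeasurableSpace ↥(archLocal L 3 (Matrix.diagonal α) w)]
  [∀ w : {w : InfinitePlace L // IsComplex w}, BorelSpace ↥(archLocal L 3 (Matrix.diagonal α) w)]
  [∀ w : {w : InfinitePlace L // IsComplex w}, MeasurableSpace ↥(archLocal L 3 (Matrix.diagonal β) w)]
  [∀ w : {w : InfinitePlace L // IsComplex w}, BorelSpace ↥(archLocal L 3 (Matrix.diagonal β) w)]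
  [MeasurableSpace ↥(arch (↥(maximalRealSubfield L)) L (IsCMField.complexConj L) 3 (Matrix.diagonal α))] [BorelSpace ↥(arch (↥(maximalRealSubfield L)) L (IsCMField.complexConj L) 3 (Matrix.diagonal α))]
  [MeasurableSpace ↥(arch (↥(maximalRealSubfield L)) L (IsCMField.complexConj L) 3 (Matrix.diagonal β))] [BorelSpace ↥(arch (↥(maximalRealSubfield L)) L (IsCMField.complexConj L) 3 (Matrix.diagonal β))]
  (ν'w : ∀ w : {w : InfinitePlace L // IsComplex w}, Measure ↥(archLocal L 3 (Matrix.diagonal α) w)) [∀ w, (ν'w w).IsHaarMeasure] [∀ w, (ν'w w).IsMulRightInvariant]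
  (νβw : ∀ w : {w : InfinitePlace L // IsComplex w}, Measure ↥(archLocal L 3 (Matrix.diagonal β) w)) [∀ w, (νβw w).IsHaarMeasure] [∀ w, (νβw w).IsMulRightInvariant]
  (ι : ∀ w' : {w : {w : InfinitePlace L // IsComplex w} // w ∉ D}, ↥(archLocal L 3 (Matrix.diagonal α) w'.1) ≃ₜ* ↥(archLocal L 3 (Matrix.diagonal β) w'.1))

/-- **(G1) «glue-PC»: THE BALL-BY-BALL TRANSFER BODY IN THE PRODUCT CONVENTION, FROM THE COUPLING (`hCoup`), THE READINGS DOCK (`hBI`) AND THE BALL SELECTION (`hSel`).**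
Output = the `hBall` argument of ★ (L2)-measures `exists_radius_ballTransferFixedBody_of_prodConvention` (p852313 §3) for THIS `a′`, with `κ = ∏_{w ∈ D} 3⁻¹`, token for token.
A pure COMBINATOR: the frame hypotheses (`hD`, `hα`, `hherm`, `β` split-chart everywhere, `hι`, `νβ_{w′} = ι_* ν′_{w′}`, `a′ ∈ C_c^∞`) are consumed by the three slice heads, not
here — the head (G2) plugs ★ `exists_coupling`, ★ LH3-p03's readings dock and ★ `exists_ballSelection` into `hCoup`, `hBI`, `hSel`; this file needs only `β_i ≠ 0` (closed embedding
`U(β)_w ↪ M₃(ℂ)`, ★ §2(7)) and the generators `hEP` on `D`.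
[cite: Rogawski1990, §14.2 (14.2.1) p. 232; §4.1 (4.1.1) p. 39; §8.2 p. 122] [cite: Shelstad1979, §4 p. 24, Lemma 4.2 p. 23] [cite: Bouaziz1994IntegralesOrbitales, §6.2 p. 591] -/
theorem exists_radius_ballTransferFixedBody_prodConvention_of_coupling_of_tsupport
    (hβ0 : ∀ i, β i ≠ 0)
    (hEP : ∀ (v : ↥D) (l : Fin 3 → ℂ), (∀ i, ‖l i‖ = 1) → EPGeneratorAt L β (v : {w : InfinitePlace L // IsComplex w}) (νβw v) (esymm3 l))
    (a' : ↥(arch (↥(maximalRealSubfield L)) L (IsCMField.complexConj L) 3 (Matrix.diagonal α)) → ℂ)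
    -- (CP) LH7-p01 (g8) `exists_coupling` (letter 2026-09-02 17:54:08Z), for THIS `a′`, at every centre `b ∈ K^D`
    (hCoup : ∀ b : ↥D → ℂ × ℂ × ℂ, (∀ v, b v ∈ Set.range fun t : Fin 3 → ℝ => esymm3 fun i => Complex.exp ((t i : ℂ) * I)) →
      ∃ εc : ℝ, 0 < εc ∧ ∃ G : (↥D → ℂ × ℂ × ℂ) → (∀ w' : {w : {w : InfinitePlace L // IsComplex w} // w ∉ D}, ↥(archLocal L 3 (Matrix.diagonal β) w'.1)) → ℂ,
        (∃ Gamb : (↥D → ℂ × ℂ × ℂ) × ({w : {w : InfinitePlace L // IsComplex w} // w ∉ D} → Matrix (Fin 3) (Fin 3) ℂ) → ℂ,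
          ContDiff ℝ ∞ Gamb ∧ (∃ KI : Set ({w : {w : InfinitePlace L // IsComplex w} // w ∉ D} → Matrix (Fin 3) (Fin 3) ℂ), IsCompact KI ∧ ∀ z, ∀ Z ∉ KI, Gamb (z, Z) = 0) ∧
          ∀ z yβ, G z yβ = Gamb (z, fun w' => ((yβ w' : GL (Fin 3) ℂ) : Matrix (Fin 3) (Fin 3) ℂ))) ∧
        ∀ x : ↥D → Fin 3 → ℝ, (∀ v, dist (esymm3 fun i => Complex.exp ((x v i : ℂ) * I)) (b v) < εc) →
          ∀ y : (∀ w' : {w : {w : InfinitePlace L // IsComplex w} // w ∉ D}, ↥(archLocal L 3 (Matrix.diagonal α) w'.1)),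
            G (fun v => esymm3 fun i => Complex.exp ((x v i : ℂ) * I)) (fun w' => ι w' (y w')) =
              ∫ g : (∀ v : ↥D, ↥(archLocal L 3 (Matrix.diagonal α) (v : {w : InfinitePlace L // IsComplex w}))),
                a' ((archPiEquivCM 3 L (Matrix.diagonal α)).symm
                  ((MeasurableEquiv.piEquivPiSubtypeProd (fun w : {w : InfinitePlace L // IsComplex w} => ↥(archLocal L 3 (Matrix.diagonal α) w)) (· ∈ D)).symm
                    (fun v => g v * gprimeBlockAt L α v.1 ∅ (x v) * (g v)⁻¹, y)))
                ∂(Measure.pi fun v : ↥D => ν'w v))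
    -- (BI) LH3-p03 (g8) `ArchEPAssemblyBallIdentity` (head wanted by (G1); per ball, both frames product convention)
    (hBI : ∀ (y : ↥D → ℂ × ℂ × ℂ) (εg : ↥D → ℝ)
      (fv : ∀ v : ↥D, ↥(archLocal L 3 (Matrix.diagonal β) (v : {w : InfinitePlace L // IsComplex w})) → ℂ) (hv : ↥D → ℂ × ℂ × ℂ → ℂ)
      (F : ↥D → ℂ × ℂ × ℂ → ℝ)
      (G : (↥D → ℂ × ℂ × ℂ) → (∀ w' : {w : {w : InfinitePlace L // IsComplex w} // w ∉ D}, ↥(archLocal L 3 (Matrix.diagonal β) w'.1)) → ℂ)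
      (f : ↥(arch (↥(maximalRealSubfield L)) L (IsCMField.complexConj L) 3 (Matrix.diagonal β)) → ℂ),
      -- the per-ball test function and its shape
      ArchSmooth L 3 (Matrix.diagonal β) f →
      (∀ k, f k = (∏ v : ↥D, (2 * (F v (bzClassG L β k v) : ℂ) * (hv v (bzClassG L β k v))⁻¹) * fv v (archPiEquivCM 3 L (Matrix.diagonal β) k v)) *
        G (fun v => bzClassG L β k v) (fun w' => archPiEquivCM 3 L (Matrix.diagonal β) k w'.1)) →
      (∀ v, Measurable (fv v)) → (∀ v, ContDiff ℝ ∞ (hv v)) → (∀ v, ContDiff ℝ ∞ (F v)) →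
      -- the generator clauses at the centre `y v` with radius `εg v`
      (∀ v z, dist z (y v) < εg v → hv v z ≠ 0) →
      (∀ (v : ↥D) (S' : Finset {w : InfinitePlace L // IsComplex w}) (c : {w : InfinitePlace L // IsComplex w} → Fin 3 → ℝ),
        (v : {w : InfinitePlace L // IsComplex w}) ∈ S' → c v 0 ≠ 0 → dist (bzClassMapG S' c v) (y v) < εg v →
          chartOrbGLoc L β (v : {w : InfinitePlace L // IsComplex w}) S' (νβw v) (fv v) (c v) = 0) →
      (∀ (v : ↥D) (S' : Finset {w : InfinitePlace L // IsComplex w}) (c : {w : InfinitePlace L // IsComplex w} → Fin 3 → ℝ),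
        (v : {w : InfinitePlace L // IsComplex w}) ∉ S' → (Function.Injective fun i : Fin 3 => Circle.exp (c v i)) → dist (bzClassMapG S' c v) (y v) < εg v →
          ∑ σ : Equiv.Perm (Fin 3), chartOrbGLoc L β (v : {w : InfinitePlace L // IsComplex w}) S' (νβw v) (fv v) (c v ∘ σ) = hv v (bzClassMapG S' c v)) →
      -- the factor lives in the generator ball
      (∀ v z, F v z ≠ 0 → dist z (y v) < εg v) →
      -- … and its closed support lives there too (the weight `2F∕h` is then continuous: ★ Ball §2 `contDiff_weight_of_tsupport_subset`)
      (∀ v, tsupport (F v) ⊆ ball (y v) (εg v)) →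
      -- the coupling's guarded transport identity at the compact labels (the (T1) `hG` letter at `z := cl`, `c_D := c|_D`)
      (∀ (S : Finset {w : InfinitePlace L // IsComplex w}) (c : {w : InfinitePlace L // IsComplex w} → Fin 3 → ℝ), c ∈ RegG S →
        (∀ v : ↥D, (v : {w : InfinitePlace L // IsComplex w}) ∉ S) → (∀ v : ↥D, F v (bzClassMapG S c v) ≠ 0) →
        ∀ yI : (∀ w' : {w : {w : InfinitePlace L // IsComplex w} // w ∉ D}, ↥(archLocal L 3 (Matrix.diagonal α) w'.1)),
          G (fun v => bzClassMapG S c v) (fun w' => ι w' (yI w')) =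
            ∫ g : (∀ v : ↥D, ↥(archLocal L 3 (Matrix.diagonal α) (v : {w : InfinitePlace L // IsComplex w}))),
              a' ((archPiEquivCM 3 L (Matrix.diagonal α)).symm
                ((MeasurableEquiv.piEquivPiSubtypeProd (fun w : {w : InfinitePlace L // IsComplex w} => ↥(archLocal L 3 (Matrix.diagonal α) w)) (· ∈ D)).symm
                  (fun v => g v * gprimeBlockAt L α v.1 S (c v) * (g v)⁻¹, yI)))
              ∂(Measure.pi fun v : ↥D => ν'w v)) →
      -- conclusion, at any pair of global measures EQUAL to the product-convention pair (hβ∕hα's `(ν′) [..] (hν)` pattern)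
      ∀ (ν' : Measure ↥(arch (↥(maximalRealSubfield L)) L (IsCMField.complexConj L) 3 (Matrix.diagonal α))) [ν'.IsHaarMeasure] [ν'.IsMulRightInvariant],
        ν' = (Measure.pi ν'w).map (archPiEquivCM 3 L (Matrix.diagonal α)).symm →
      ∀ (νβ : Measure ↥(arch (↥(maximalRealSubfield L)) L (IsCMField.complexConj L) 3 (Matrix.diagonal β))) [νβ.IsHaarMeasure] [νβ.IsMulRightInvariant],
        νβ = (Measure.pi νβw).map (archPiEquivCM 3 L (Matrix.diagonal β)).symm →
      ∀ (S : Finset {w : InfinitePlace L // IsComplex w}) (c : {w : InfinitePlace L // IsComplex w} → Fin 3 → ℝ), c ∈ RegG S →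
        stableSumG (orbFamGExt L β νβ f) S c =
          ((3 : ℂ)⁻¹) ^ Fintype.card ↥D * stableSumG (orbFamGExt L α ν' (fun k => ((∏ v, F v (bzClassG L α k v) : ℝ) : ℂ) * a' k)) S c)
    -- ball selection, LH1-p01 (g12) `exists_ballSelection` (letter LH7-p04 (g8) 17:36:45Z), at the index `↥D` and the compact class image `K`
    (hSel : ∀ (ε : ↥D → ℂ × ℂ × ℂ → ℝ), (∀ v b, 0 < ε v b) → ∀ ρGT : (↥D → ℂ × ℂ × ℂ) → ℝ,
      (∀ y, (∀ v, y v ∈ Set.range fun t : Fin 3 → ℝ => esymm3 fun i => Complex.exp ((t i : ℂ) * I)) → 0 < ρGT y) →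
      ∃ δ : ℝ, 0 < δ ∧ ∀ ctr : ↥D → ℂ × ℂ × ℂ, (∀ v, ctr v ∈ Set.range fun t : Fin 3 → ℝ => esymm3 fun i => Complex.exp ((t i : ℂ) * I)) →
        ∃ y : ↥D → ℂ × ℂ × ℂ, (∀ v, y v ∈ Set.range fun t : Fin 3 → ℝ => esymm3 fun i => Complex.exp ((t i : ℂ) * I)) ∧
          (∀ v, ball (ctr v) δ ⊆ ball (y v) (ε v (y v))) ∧ ∀ v, ball (ctr v) δ ⊆ ball (y v) (ρGT y)) :
    haveI := isHaarMeasure_prodConventionG L α ν'w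
    haveI := isMulRightInvariant_prodConventionG L α ν'w
    haveI := isHaarMeasure_prodConventionG L β νβw
    haveI := isMulRightInvariant_prodConventionG L β νβw
    ∃ ε : {w : InfinitePlace L // IsComplex w} → ℂ × ℂ × ℂ → ℝ, (∀ w b, 0 < ε w b) ∧
      ∀ (ctr : ↥D → ℂ × ℂ × ℂ) (F : ↥D → ℂ × ℂ × ℂ → ℝ),
      (∀ v, ctr v ∈ Set.range fun t : Fin 3 → ℝ => esymm3 fun i => Complex.exp ((t i : ℂ) * I)) → (∀ v, ContDiff ℝ ∞ (F v)) →
      (∀ v, tsupport (F v) ⊆ ball (ctr v) (ε v (ctr v))) →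
        ∃ f : ↥(arch (↥(maximalRealSubfield L)) L (IsCMField.complexConj L) 3 (Matrix.diagonal β)) → ℂ, ArchSmooth L 3 (Matrix.diagonal β) f ∧
          ∀ (S : Finset {w : InfinitePlace L // IsComplex w}) (c : {w : InfinitePlace L // IsComplex w} → Fin 3 → ℝ), c ∈ RegG S →
            stableSumG (orbFamGExt L β ((Measure.pi νβw).map (archPiEquivCM 3 L (Matrix.diagonal β)).symm) f) S c =
              (∏ _w ∈ D, (3 : ℂ)⁻¹) * stableSumG (orbFamGExt L α ((Measure.pi ν'w).map (archPiEquivCM 3 L (Matrix.diagonal α)).symm)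
                (fun k => ((∏ v, F v (bzClassG L α k v) : ℝ) : ℂ) * a' k)) S c := by
  -- (0) the generator tuple on the block `D` (★ (L2)§3) and the coupling choice functions (`hCoup`)
  obtain ⟨εg, fg, hg, hεg, hclauses⟩ :=
    exists_epGenerator_choice_pi L β (fun v : ↥D => (v : {w : InfinitePlace L // IsComplex w})) (fun v => νβw v) hEP
  choose εc hεc Gc hGc using hCoup
  -- (1) RADIUS: the ball selection for `ρ(y) = min_v εg v (y v) ⊓ εc y` on `K^D` (`hSel`), constant radius `δ`
  set ρGT : (↥D → ℂ × ℂ × ℂ) → ℝ := fun y =>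
    if hy : ∀ v, y v ∈ Set.range fun t : Fin 3 → ℝ => esymm3 fun i => Complex.exp ((t i : ℂ) * I) then εc y hy else 1 with hρGT_def
  have hρGT : ∀ y, (∀ v, y v ∈ Set.range fun t : Fin 3 → ℝ => esymm3 fun i => Complex.exp ((t i : ℂ) * I)) → 0 < ρGT y := by
    intro y hy
    simp only [hρGT_def, dif_pos hy]
    exact hεc y hy
  obtain ⟨δ, hδ, hsel⟩ := hSel εg hεg ρGT hρGT
  refine ⟨fun _ _ => δ, fun _ _ => hδ, fun ctr F hctr hF hFsupp => ?_⟩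
  -- (2) PER BALL: select the centre `y`, read the generator and coupling data there
  obtain ⟨y, hyK, hyε, hyGT⟩ := hsel ctr hctr
  have hgen := fun v : ↥D => hclauses v (y v) (hyK v)
  obtain ⟨⟨Gamb, hGamb, ⟨KI, hKI, hG0⟩, hGeq⟩, hGid⟩ := hGc y hyK
  have hρy : ρGT y = εc y hyK := by simp only [hρGT_def, dif_pos hyK]
  -- the factor `F v` lives in the generator ball and in the coupling ball; the weight denominators do not vanish on its support
  have hFε : ∀ v z, F v z ≠ 0 → dist z (y v) < εg v (y v) := fun v z hz =>
    Metric.mem_ball.1 (hyε v (hFsupp v (subset_tsupport (F v) (Function.mem_support.2 hz))))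
  have hFc : ∀ v z, F v z ≠ 0 → dist z (y v) < εc y hyK := fun v z hz =>
    hρy ▸ Metric.mem_ball.1 (hyGT v (hFsupp v (subset_tsupport (F v) (Function.mem_support.2 hz))))
  have hFh : ∀ v, tsupport (F v) ⊆ {z | hg v (y v) z ≠ 0} := fun v z hz =>
    (hgen v).2.2.2.1 z (Metric.mem_ball.1 (hyε v (hFsupp v hz)))
  -- the per-ball test function `f_J`
  set fJ : ↥(arch (↥(maximalRealSubfield L)) L (IsCMField.complexConj L) 3 (Matrix.diagonal β)) → ℂ := fun k =>
    (∏ v : ↥D, (2 * (F v (bzClassG L β k v) : ℂ) * (hg v (y v) (bzClassG L β k v))⁻¹) * fg v (y v) (archPiEquivCM 3 L (Matrix.diagonal β) k v)) *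
      Gc y hyK (fun v => bzClassG L β k v) (fun w' => archPiEquivCM 3 L (Matrix.diagonal β) k w'.1) with hfJ_def
  -- `f_J ∈ C_c^∞(U(β)_∞)` (★ §2(7) with the coupling's ambient certificate)
  have hfJ : ArchSmooth L 3 (Matrix.diagonal β) fJ := by
    have h27 := archSmooth_prod_classMul_tensor_mul_coupling_of_forall_eq_zero L β hβ0 D
      (I := {w : {w : InfinitePlace L // IsComplex w} // w ∉ D}) (fun w' => (w'.1 : {w : InfinitePlace L // IsComplex w})) (fun w hw => ⟨⟨w, hw⟩, rfl⟩)
      (fun v z => 2 * (F v z : ℂ) * (hg v (y v) z)⁻¹) (fun v => contDiff_weight_of_tsupport_subset (hF v) (hgen v).2.2.1 (hFh v))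
      (fun v => fg v (y v)) (fun v => (hgen v).1) (fun v => (hgen v).2.1) Gamb hGamb hKI hG0
    have e : fJ = fun k =>
        (∏ v : ↥D, (2 * (F v (bzClassG L β k v) : ℂ) * (hg v (y v) (bzClassG L β k v))⁻¹) * fg v (y v) (archPiEquivCM 3 L (Matrix.diagonal β) k v)) *
          Gamb (fun v : ↥D => bzClassG L β k v, fun w' : {w : {w : InfinitePlace L // IsComplex w} // w ∉ D} =>
            ((archPiEquivCM 3 L (Matrix.diagonal β) k (w'.1 : {w : InfinitePlace L // IsComplex w}) : GL (Fin 3) ℂ) : Matrix (Fin 3) (Fin 3) ℂ)) := by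
      funext k
      simp only [hfJ_def, hGeq]
    rw [e]
    exact h27
  refine ⟨fJ, hfJ, fun S c hc => ?_⟩
  -- (3) the coupling's ball identity, moved from the label `∅` to the compact label `S` (J2∕J3), is `hBI`'s guarded transport hypothesis
  have hG : ∀ (S : Finset {w : InfinitePlace L // IsComplex w}) (c : {w : InfinitePlace L // IsComplex w} → Fin 3 → ℝ), c ∈ RegG S →
      (∀ v : ↥D, (v : {w : InfinitePlace L // IsComplex w}) ∉ S) → (∀ v : ↥D, F v (bzClassMapG S c v) ≠ 0) →
      ∀ yI : (∀ w' : {w : {w : InfinitePlace L // IsComplex w} // w ∉ D}, ↥(archLocal L 3 (Matrix.diagonal α) w'.1)),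
        Gc y hyK (fun v => bzClassMapG S c v) (fun w' => ι w' (yI w')) =
          ∫ g : (∀ v : ↥D, ↥(archLocal L 3 (Matrix.diagonal α) (v : {w : InfinitePlace L // IsComplex w}))),
            a' ((archPiEquivCM 3 L (Matrix.diagonal α)).symm
              ((MeasurableEquiv.piEquivPiSubtypeProd (fun w : {w : InfinitePlace L // IsComplex w} => ↥(archLocal L 3 (Matrix.diagonal α) w)) (· ∈ D)).symm
                (fun v => g v * gprimeBlockAt L α v.1 S (c v) * (g v)⁻¹, yI)))
            ∂(Measure.pi fun v : ↥D => ν'w v) := by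
    intro S c _hc hDS hFne yI
    have e1 : (fun v : ↥D => esymm3 fun i => Complex.exp ((c v i : ℂ) * I)) = fun v : ↥D => bzClassMapG S c (v : {w : InfinitePlace L // IsComplex w}) := by
      funext v
      rw [bzClassMapG_apply, chartEigG_of_not_mem (hDS v)]
    have e2 : ∀ v : ↥D, gprimeBlockAt L α v.1 ∅ (c v) = gprimeBlockAt L α v.1 S (c v) := fun v =>
      congrFun (gprimeBlockAt_eq_of_mem_iff L α v.1 (S' := ∅) (S'' := S) (iff_of_false (Finset.notMem_empty _) (hDS v))) (c v)
    have hx : ∀ v : ↥D, dist (esymm3 fun i => Complex.exp ((c v i : ℂ) * I)) (y v) < εc y hyK := by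
      intro v
      have := hFc v _ (hFne v)
      rwa [bzClassMapG_apply, chartEigG_of_not_mem (hDS v)] at this
    have h := hGid (fun v => c v) hx yI
    rw [e1] at h
    simp_rw [e2] at h
    exact h
  -- measurability of the one-place generator factors (restrictions of ambient smooth functions)
  have hfvm : ∀ v : ↥D, Measurable (fg v (y v)) := by
    intro v
    obtain ⟨fa, hfa, hfa'⟩ := (hgen v).1
    have : fg v (y v) = fa ∘ fun g : ↥(archLocal L 3 (Matrix.diagonal β) (v : {w : InfinitePlace L // IsComplex w})) =>
        ((g : GL (Fin 3) ℂ) : Matrix (Fin 3) (Fin 3) ℂ) := funext hfa'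
    rw [this]
    exact (hfa.continuous.comp (isClosedEmbedding_coe_coe_archLocal_diagonal L β hβ0 _).continuous).measurable
  -- (4) the per-ball identity from the readings dock `hBI`
  haveI := isHaarMeasure_prodConventionG L α ν'w
  haveI := isMulRightInvariant_prodConventionG L α ν'w
  haveI := isHaarMeasure_prodConventionG L β νβw
  haveI := isMulRightInvariant_prodConventionG L β νβw
  have hId := hBI y (fun v => εg v (y v)) (fun v => fg v (y v)) (fun v => hg v (y v)) F (Gc y hyK) fJ hfJ (fun k => rfl)
    hfvm (fun v => (hgen v).2.2.1) hF (fun v => (hgen v).2.2.2.1) (fun v => (hgen v).2.2.2.2.1) (fun v => (hgen v).2.2.2.2.2) hFε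
    (fun v => (hFsupp v).trans (hyε v)) hG
    ((Measure.pi ν'w).map (archPiEquivCM 3 L (Matrix.diagonal α)).symm) rfl
    ((Measure.pi νβw).map (archPiEquivCM 3 L (Matrix.diagonal β)).symm) rfl S c hc
  rw [hId, Finset.prod_const, Fintype.card_coe]

end GluePC

end Literature.NumberTheory.Rogawski1990

end
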